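import Summits.AtomisticToContinuum.FouriersLaw.Theorems.BondHeatUncertaintyDefs
import Summits.AtomisticToContinuum.FouriersLaw.Theorems.BondHeatUncertaintyLinearResponseFTURSchemeConvergence
import Summits.AtomisticToContinuum.FouriersLaw.Theorems.BondHeatUncertaintySubdiffusiveBondHeatKernelGibbsA
import Summits.AtomisticToContinuum.FouriersLaw.Theorems.BondHeatUncertaintyLinearResponseFTURPathLebesgueDuality
import Literature.MathematicalPhysics.KineticTheory.LangevinChainReversal

/-!
# The forward and the anti-damped paths as forced frictionless flows (K3 helper)

Helper file for stub `stub_antiDampedGirsanov` (K3) of line `lebesgue-flip-duality`, crux ★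
`BondHeatUncertainty.LinearResponseFTUR` (stmt-AtomisticToContinuum-9122). Pathwise identities, for a
fixed raw Brownian pair `w` with noise `n = pairNoise v_L v_R (pairPath w)`:

* `pinnedChain_drift_eq_frictionless` — `Y_γ = Y₀ - γ Π` (`Y₀` the Hamiltonian vector field = the
  drift of the frictionless chain `pinnedChain ω₂ lam β 0`, `Π = frictionVec`);
* `theta_drift_theta` — `Θ Y_γ(Θ z) = -(Y₀ z + γ Π z)` (`Θ` the momentum flip `thetaCLM`);
* `fwdPath_integralEq` — the forward path `X = fwdPath` solves
  `X(s) = y + (n(s) - γ ∫₀ˢ Π(X)) + ∫₀ˢ Y₀(X)` (the `(ε, σ) = (1, 1)` equation of the schemes);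
* `thetaRevPath_integralEq` — `Z = Θ ∘ revPath(Θ y)` (the ANTI-damped path from `y`) solves
  `Z(s) = y + (-n(s) + γ ∫₀ˢ Π(Z)) + ∫₀ˢ Y₀(Z)` (the `(ε, σ) = (-1, -1)` equation);
* `obs_theta_revPath` — `swapObs (flipObs (rawObs (Θ y) (revPath (Θ y) w))) = rawObs y Z`
  (the work integrals and the bond heat are odd under `Θ`);
-/

noncomputable section

namespace Summit.AtomisticToContinuum.FouriersLaw.Theorems.LinearResponseFTUR

open MeasureTheory Filter Set Function intervalIntegral Topology
open scoped NNReal ENNReal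
open Literature.MathematicalPhysics.KineticTheory
open Literature.MathematicalPhysics.KineticTheory.HeatConduction
open Literature.Probability.Process
open Literature.Analysis.ODE
open Summit.AtomisticToContinuum.FouriersLaw.Theorems.BondHeatUncertainty
open Summit.AtomisticToContinuum.FouriersLaw.Theorems.SubdiffusiveBondHeat

variable {N : ℕ}

/-! ### The momentum flip -/

/-- The momentum flip `Θ (q, p) = (q, -p)` as a continuous linear map. -/
def thetaCLM (N : ℕ) : PhaseSpace N →L[ℝ] PhaseSpace N :=
  (ContinuousLinearMap.fst ℝ _ _).prod (-(ContinuousLinearMap.snd ℝ _ _))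

/-- `Θ (q, p) = (q, -p)`. -/
@[simp] theorem thetaCLM_apply (z : PhaseSpace N) : thetaCLM N z = (z.1, -z.2) := by
  simp [thetaCLM]

/-- `Θ` is an involution. -/
theorem thetaCLM_thetaCLM (z : PhaseSpace N) : thetaCLM N (thetaCLM N z) = z := by
  simp

/-- A momentum vector is negated by `Θ`. -/
theorem thetaCLM_of_mem {e : PhaseSpace N} (he : e ∈ momentumSubspace N) : thetaCLM N e = -e := by
  rw [mem_momentumSubspace] at he
  ext i <;> simp [he]

/-! ### The drift: friction splitting and `Θ`-conjugation -/

/-- The Hamiltonian does not see the friction constant. -/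
theorem pinnedChain_hamiltonian_eq (ω₂ lam β γ : ℝ) (N : ℕ) :
    (pinnedChain ω₂ lam β γ).hamiltonian N = (pinnedChain ω₂ lam β 0).hamiltonian N := rfl

/-- Nor do the forces. -/
theorem pinnedChain_dPotential_eq (ω₂ lam β γ : ℝ) (N : ℕ) :
    (pinnedChain ω₂ lam β γ).dPotential N = (pinnedChain ω₂ lam β 0).dPotential N := rfl

/-- The position component of the friction direction vanishes. -/
@[simp] theorem frictionVec_fst (z : PhaseSpace N) : (frictionVec N z).1 = 0 := by
  simp [frictionVec, bathVec]

/-- The momentum components of the friction direction: `Π(z)_i = ([i = 0] + [i = N-1]) p_i`. -/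
theorem frictionVec_snd (z : PhaseSpace N) (i : Fin N) : (frictionVec N z).2 i = OscillatorChain.bathWeight N i * z.2 i := by
  have hN : 0 < N := Fin.pos i
  simp only [frictionVec, bathVec, leftMom, rightMom, dif_pos hN, Prod.snd_add, Pi.add_apply,
    OscillatorChain.bathWeight]
  have e0 : i.val = 0 → (⟨0, hN⟩ : Fin N) = i := fun h => Fin.ext h.symm
  have e1 : i.val = N - 1 → (⟨N - 1, by omega⟩ : Fin N) = i := fun h => Fin.ext h.symm
  by_cases h0 : i.val = 0
  · by_cases h1 : i.val = N - 1
    · rw [if_pos h0, if_pos h1, if_pos h0, if_pos h1, e0 h0]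
      conv_lhs => rw [e1 h1]
      ring
    · rw [if_pos h0, if_neg h1, if_pos h0, if_neg h1, e0 h0]; ring
  · by_cases h1 : i.val = N - 1
    · rw [if_neg h0, if_pos h1, if_neg h0, if_pos h1, e1 h1]; ring
    · rw [if_neg h0, if_neg h1, if_neg h0, if_neg h1]; ring

/-- The closed form of the drift of the pinned chain. -/
theorem pinnedChain_drift_apply (ω₂ lam β γ : ℝ) (N : ℕ) (z : PhaseSpace N) :
    (pinnedChain ω₂ lam β γ).drift N z =
      (z.2, fun i => -(pinnedChain ω₂ lam β γ).dPotential N i z.1 - γ * OscillatorChain.bathWeight N i * z.2 i) := by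
  have hU : Differentiable ℝ (pinnedChain ω₂ lam β γ).U :=
    (pinnedChain_contDiff_U ω₂ lam β γ (n := 1)).differentiable one_ne_zero
  have hV : Differentiable ℝ (pinnedChain ω₂ lam β γ).V :=
    (pinnedChain_contDiff_V ω₂ lam β γ (n := 1)).differentiable one_ne_zero
  rw [OscillatorChain.drift_eq _ hU hV]
  rfl

/-- **Friction splitting of the drift**: `Y_γ(z) = Y₀(z) - γ Π(z)`. -/
theorem pinnedChain_drift_eq_frictionless (ω₂ lam β γ : ℝ) (N : ℕ) (z : PhaseSpace N) :
    (pinnedChain ω₂ lam β γ).drift N z = (pinnedChain ω₂ lam β 0).drift N z - γ • frictionVec N z := by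
  rw [pinnedChain_drift_apply, pinnedChain_drift_apply, pinnedChain_dPotential_eq]
  ext i
  · simp
  · simp only [Prod.snd_sub, Pi.sub_apply, Prod.smul_snd, Pi.smul_apply, smul_eq_mul, frictionVec_snd]
    ring

/-- **`Θ`-conjugation of the drift**: `Θ Y_γ(Θ z) = -(Y₀(z) + γ Π(z))` — the `Θ`-conjugate of the
reversed-drift dynamics is the ANTI-damped dynamics. -/
theorem theta_drift_theta (ω₂ lam β γ : ℝ) (N : ℕ) (z : PhaseSpace N) :
    thetaCLM N ((pinnedChain ω₂ lam β γ).drift N (thetaCLM N z)) =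
      -((pinnedChain ω₂ lam β 0).drift N z + γ • frictionVec N z) := by
  rw [pinnedChain_drift_apply, pinnedChain_drift_apply, pinnedChain_dPotential_eq]
  ext i
  · simp
  · simp only [thetaCLM_apply, Pi.neg_apply, Prod.snd_neg, Prod.snd_add, Pi.add_apply, Prod.smul_snd,
      Pi.smul_apply, smul_eq_mul, frictionVec_snd, neg_neg, mul_neg, sub_neg_eq_add, neg_add_rev]
    ring

/-! ### The two paths as forced frictionless flows -/

section Paths

/-- The noise path of the chain driven by the Brownian pair of the raw sample `w`. -/
def chainPairNoise (ω₂ lam β γ : ℝ) (N : ℕ) (T_L T_R : ℝ) (w : WienerPair) : ℝ → PhaseSpace N :=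
  pairNoise ((pinnedChain ω₂ lam β γ).bathVecL N T_L) ((pinnedChain ω₂ lam β γ).bathVecR N T_R) (pairPath w)

/-- The noise path is continuous. -/
theorem continuous_chainPairNoise (ω₂ lam β γ : ℝ) (N : ℕ) (T_L T_R : ℝ) (w : WienerPair) :
    Continuous (chainPairNoise ω₂ lam β γ N T_L T_R w) :=
  continuous_pairNoise _ _ _

/-- The noise path takes values in the momentum subspace. -/
theorem chainPairNoise_mem (ω₂ lam β γ : ℝ) (N : ℕ) (T_L T_R : ℝ) (w : WienerPair) (s : ℝ) :
    chainPairNoise ω₂ lam β γ N T_L T_R w s ∈ momentumSubspace N :=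
  pairNoise_mem _ _ (bathVec_mem_momentumSubspace N _ _) (bathVec_mem_momentumSubspace N _ _) _ s

/-- The noise path starts at `0`. -/
@[simp] theorem chainPairNoise_zero (ω₂ lam β γ : ℝ) (N : ℕ) (T_L T_R : ℝ) (w : WienerPair) :
    chainPairNoise ω₂ lam β γ N T_L T_R w 0 = 0 :=
  pairNoise_zero _ _ _

/-- The noise path in closed form: `n(s) = c_L B¹(s⁺) e_0 + c_R B²(s⁺) e_{N-1}`, i.e. the `noiseImpulse` of
the pair of Brownian values. -/
theorem chainPairNoise_apply (ω₂ lam β γ : ℝ) (N : ℕ) (T_L T_R : ℝ) (w : WienerPair) (s : ℝ) :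
    chainPairNoise ω₂ lam β γ N T_L T_R w s =
      noiseImpulse N (Real.sqrt (2 * γ * T_L)) (Real.sqrt (2 * γ * T_R))
        (brownian s.toNNReal w.1, brownian s.toNNReal w.2) := by
  unfold chainPairNoise
  rw [pairNoise_pairPath]
  simp only [noiseImpulse, OscillatorChain.bathVecL, OscillatorChain.bathVecR, SchemeData.smul_bathVec]
  show bathVec N 0 (brownian s.toNNReal w.1 * Real.sqrt (2 * γ * T_L)) +
      bathVec N (N - 1) (brownian s.toNNReal w.2 * Real.sqrt (2 * γ * T_R)) = _
  rw [mul_comm, mul_comm (brownian s.toNNReal w.2)]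

/-- The forward path is the forced flow of the damped drift driven by the noise path. -/
theorem fwdPath_eq_drivenFlow (ω₂ lam β γ : ℝ) (N : ℕ) (T_L T_R : ℝ) (y : PhaseSpace N) (w : WienerPair) :
    fwdPath (pinnedChain ω₂ lam β γ) N T_L T_R y w =
      fun s => drivenFlow ((pinnedChain ω₂ lam β γ).drift N) y (chainPairNoise ω₂ lam β γ N T_L T_R w) s := by
  funext s
  simp only [fwdPath, ← pinnedChain_langevinSolMap_eq_solMap]
  rfl

/-- The reversed-drift path is the forced flow of `-Y_γ`. -/
theorem revPath_eq_drivenFlow (ω₂ lam β γ : ℝ) (N : ℕ) (T_L T_R : ℝ) (y' : PhaseSpace N) (w : WienerPair) :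
    revPath (pinnedChain ω₂ lam β γ) N T_L T_R y' w =
      fun s => drivenFlow (fun x => -(pinnedChain ω₂ lam β γ).drift N x) y'
        (chainPairNoise ω₂ lam β γ N T_L T_R w) s := rfl

variable {ω₂ lam β γ : ℝ} (hω : 0 < ω₂) (hl : 0 ≤ lam) (hβ : 0 ≤ β) (hγ : 0 ≤ γ) (N : ℕ) (T_L T_R : ℝ)
include hω hl hβ hγ

/-- The forward path is continuous. -/
theorem continuous_fwdPath (y : PhaseSpace N) (w : WienerPair) :
    Continuous (fwdPath (pinnedChain ω₂ lam β γ) N T_L T_R y w) := by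
  rw [fwdPath_eq_drivenFlow]
  exact ((pinnedChain_isConfining hω hl hβ hγ).confinedDrift N).toConfinedDrift.continuous_flow y
    (continuous_chainPairNoise ω₂ lam β γ N T_L T_R w) (chainPairNoise_mem ω₂ lam β γ N T_L T_R w)

/-- **The forward path solves the `(ε, σ) = (1, 1)` equation**:
`X(s) = y + (1 • n(s) - (1·γ) • ∫₀ˢ Π(X)) + ∫₀ˢ Y₀(X)` on every `[0, T]`. -/
theorem fwdPath_integralEq (y : PhaseSpace N) (w : WienerPair) (T : ℝ) :
    ∀ s ∈ Icc 0 T, fwdPath (pinnedChain ω₂ lam β γ) N T_L T_R y w s =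
      y + ((1 : ℝ) • chainPairNoise ω₂ lam β γ N T_L T_R w s -
        (1 * γ) • ∫ u in (0 : ℝ)..s, frictionVec N (fwdPath (pinnedChain ω₂ lam β γ) N T_L T_R y w u)) +
      ∫ u in (0 : ℝ)..s, (pinnedChain ω₂ lam β 0).drift N (fwdPath (pinnedChain ω₂ lam β γ) N T_L T_R y w u) := by
  intro s hs
  set D := ((pinnedChain_isConfining hω hl hβ hγ).confinedDrift N).toConfinedDrift with hD
  have hXc := continuous_fwdPath hω hl hβ hγ N T_L T_R y w
  have hsol := D.isIntegralSolutionOn_flow y (continuous_chainPairNoise ω₂ lam β γ N T_L T_R w)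
    (chainPairNoise_mem ω₂ lam β γ N T_L T_R w) T s hs
  have hX : ∀ u, drivenFlow ((pinnedChain ω₂ lam β γ).drift N) y (chainPairNoise ω₂ lam β γ N T_L T_R w) u =
      fwdPath (pinnedChain ω₂ lam β γ) N T_L T_R y w u :=
    fun u => (congrFun (fwdPath_eq_drivenFlow ω₂ lam β γ N T_L T_R y w) u).symm
  simp only [hX] at hsol
  rw [hsol]
  have h0c : Continuous fun u => (pinnedChain ω₂ lam β 0).drift N (fwdPath (pinnedChain ω₂ lam β γ) N T_L T_R y w u) :=
    ((pinnedChain_isConfining hω hl hβ le_rfl).confinedDrift N).contDiff_drift.continuous.comp hXc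
  have hPc : Continuous fun u => γ • frictionVec N (fwdPath (pinnedChain ω₂ lam β γ) N T_L T_R y w u) :=
    ((continuous_frictionVec N).comp hXc).const_smul γ
  have hi0 : IntervalIntegrable (fun u => (pinnedChain ω₂ lam β 0).drift N
      (fwdPath (pinnedChain ω₂ lam β γ) N T_L T_R y w u)) volume 0 s := h0c.intervalIntegrable 0 s
  have hiP : IntervalIntegrable (fun u => γ • frictionVec N
      (fwdPath (pinnedChain ω₂ lam β γ) N T_L T_R y w u)) volume 0 s := hPc.intervalIntegrable 0 s
  have hsplit : ∫ u in (0 : ℝ)..s, (pinnedChain ω₂ lam β γ).drift N (fwdPath (pinnedChain ω₂ lam β γ) N T_L T_R y w u) =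
      (∫ u in (0 : ℝ)..s, (pinnedChain ω₂ lam β 0).drift N (fwdPath (pinnedChain ω₂ lam β γ) N T_L T_R y w u)) -
        γ • ∫ u in (0 : ℝ)..s, frictionVec N (fwdPath (pinnedChain ω₂ lam β γ) N T_L T_R y w u) := by
    rw [← intervalIntegral.integral_smul, ← intervalIntegral.integral_sub hi0 hiP]
    refine intervalIntegral.integral_congr fun u _ => ?_
    exact pinnedChain_drift_eq_frictionless ω₂ lam β γ N _
  rw [hsplit, one_smul, one_mul]
  abel

/-- The `Θ`-conjugate of the reversed-drift path from `Θ y`: the ANTI-damped path from `y`. -/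
def thetaRevPath (ω₂ lam β γ : ℝ) (N : ℕ) (T_L T_R : ℝ) (y : PhaseSpace N) (w : WienerPair) :
    ℝ → PhaseSpace N :=
  fun s => thetaCLM N (revPath (pinnedChain ω₂ lam β γ) N T_L T_R (y.1, -y.2) w s)

/-- The reversed-drift path is continuous. -/
theorem continuous_revPath (y' : PhaseSpace N) (w : WienerPair) :
    Continuous (revPath (pinnedChain ω₂ lam β γ) N T_L T_R y' w) :=
  ((pinnedChain_isConfining hω hl hβ hγ).reversedDrift N).toConfinedDrift.continuous_flow y'
    (continuous_chainPairNoise ω₂ lam β γ N T_L T_R w) (chainPairNoise_mem ω₂ lam β γ N T_L T_R w)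

/-- The anti-damped path is continuous. -/
theorem continuous_thetaRevPath (y : PhaseSpace N) (w : WienerPair) :
    Continuous (thetaRevPath ω₂ lam β γ N T_L T_R y w) :=
  (thetaCLM N).continuous.comp (continuous_revPath hω hl hβ hγ N T_L T_R _ w)

/-- **The anti-damped path solves the `(ε, σ) = (-1, -1)` equation**:
`Z(s) = y + ((-1) • n(s) - ((-1)·γ) • ∫₀ˢ Π(Z)) + ∫₀ˢ Y₀(Z)` on every `[0, T]`. -/
theorem thetaRevPath_integralEq (y : PhaseSpace N) (w : WienerPair) (T : ℝ) :
    ∀ s ∈ Icc 0 T, thetaRevPath ω₂ lam β γ N T_L T_R y w s =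
      y + ((-1 : ℝ) • chainPairNoise ω₂ lam β γ N T_L T_R w s -
        (-1 * γ) • ∫ u in (0 : ℝ)..s, frictionVec N (thetaRevPath ω₂ lam β γ N T_L T_R y w u)) +
      ∫ u in (0 : ℝ)..s, (pinnedChain ω₂ lam β 0).drift N (thetaRevPath ω₂ lam β γ N T_L T_R y w u) := by
  intro s hs
  set D' := ((pinnedChain_isConfining hω hl hβ hγ).reversedDrift N).toConfinedDrift with hD'
  set V := revPath (pinnedChain ω₂ lam β γ) N T_L T_R (y.1, -y.2) w with hV
  have hVc : Continuous V := continuous_revPath hω hl hβ hγ N T_L T_R _ w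
  have hsol := D'.isIntegralSolutionOn_flow (y.1, -y.2) (continuous_chainPairNoise ω₂ lam β γ N T_L T_R w)
    (chainPairNoise_mem ω₂ lam β γ N T_L T_R w) T s hs
  change V s = ((y.1, -y.2) + chainPairNoise ω₂ lam β γ N T_L T_R w s) +
    ∫ u in (0 : ℝ)..s, -(pinnedChain ω₂ lam β γ).drift N (V u) at hsol
  have hZV : ∀ u, V u = thetaCLM N (thetaRevPath ω₂ lam β γ N T_L T_R y w u) := fun u => by
    simp only [thetaRevPath, thetaCLM_thetaCLM, hV]
  -- apply `Θ`
  have hdc : Continuous fun u => -(pinnedChain ω₂ lam β γ).drift N (V u) :=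
    (((pinnedChain_isConfining hω hl hβ hγ).confinedDrift N).contDiff_drift.continuous.comp hVc).neg
  have hint : IntervalIntegrable (fun u => -(pinnedChain ω₂ lam β γ).drift N (V u)) volume 0 s :=
    hdc.intervalIntegrable 0 s
  have hΘ : thetaRevPath ω₂ lam β γ N T_L T_R y w s = thetaCLM N (V s) := rfl
  rw [hΘ, hsol, map_add, map_add, ← (thetaCLM N).intervalIntegral_comp_comm hint,
    thetaCLM_of_mem (chainPairNoise_mem ω₂ lam β γ N T_L T_R w s)]
  have hy : thetaCLM N (y.1, -y.2) = y := by simp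
  rw [hy]
  have hinner : ∀ u, thetaCLM N (-(pinnedChain ω₂ lam β γ).drift N (V u)) =
      (pinnedChain ω₂ lam β 0).drift N (thetaRevPath ω₂ lam β γ N T_L T_R y w u) +
        γ • frictionVec N (thetaRevPath ω₂ lam β γ N T_L T_R y w u) := by
    intro u
    rw [map_neg, hZV u, theta_drift_theta, neg_neg]
  simp_rw [hinner]
  have hZc : Continuous (thetaRevPath ω₂ lam β γ N T_L T_R y w) := continuous_thetaRevPath hω hl hβ hγ N T_L T_R y w
  have h0c : Continuous fun u => (pinnedChain ω₂ lam β 0).drift N (thetaRevPath ω₂ lam β γ N T_L T_R y w u) :=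
    ((pinnedChain_isConfining hω hl hβ le_rfl).confinedDrift N).contDiff_drift.continuous.comp hZc
  have hPc : Continuous fun u => γ • frictionVec N (thetaRevPath ω₂ lam β γ N T_L T_R y w u) :=
    ((continuous_frictionVec N).comp hZc).const_smul γ
  have hi0 : IntervalIntegrable (fun u => (pinnedChain ω₂ lam β 0).drift N
      (thetaRevPath ω₂ lam β γ N T_L T_R y w u)) volume 0 s := h0c.intervalIntegrable 0 s
  have hiP : IntervalIntegrable (fun u => γ • frictionVec N
      (thetaRevPath ω₂ lam β γ N T_L T_R y w u)) volume 0 s := hPc.intervalIntegrable 0 s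
  rw [intervalIntegral.integral_add hi0 hiP, intervalIntegral.integral_smul]
  simp only [neg_smul, one_smul, neg_mul, one_mul]
  abel

end Paths

/-! ### The raw observables under `Θ` -/

/-- The force is even in the momenta: `∂_{q_i} H (Θ v) = ∂_{q_i} H (v)`. -/
theorem partialQ_hamiltonian_theta (ω₂ lam β γ : ℝ) (i : Fin N) (v : PhaseSpace N) :
    partialQ i ((pinnedChain ω₂ lam β γ).hamiltonian N) (thetaCLM N v) =
      partialQ i ((pinnedChain ω₂ lam β γ).hamiltonian N) v := by
  have hU : Differentiable ℝ (pinnedChain ω₂ lam β γ).U :=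
    (pinnedChain_contDiff_U ω₂ lam β γ (n := 1)).differentiable one_ne_zero
  have hV : Differentiable ℝ (pinnedChain ω₂ lam β γ).V :=
    (pinnedChain_contDiff_V ω₂ lam β γ (n := 1)).differentiable one_ne_zero
  rw [OscillatorChain.partialQ_hamiltonian_eq_dPotential _ hU hV,
    OscillatorChain.partialQ_hamiltonian_eq_dPotential _ hU hV, thetaCLM_apply]

/-- The bond current is odd in the momenta. -/
theorem bondCurrent_theta (P : OscillatorChain) (i : Fin N) (v : PhaseSpace N) :
    P.bondCurrent N i (thetaCLM N v) = -P.bondCurrent N i v := by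
  simp only [OscillatorChain.bondCurrent, thetaCLM_apply, Pi.neg_apply, ← Finset.sum_neg_distrib]
  refine Finset.sum_congr rfl fun j _ => ?_
  split_ifs
  · ring
  · simp

/-- The work integral is odd under `Θ`. -/
theorem workIntegral_theta (ω₂ lam β γ : ℝ) (i : Fin N) (t : ℝ) (V : ℝ → PhaseSpace N) :
    workIntegral (pinnedChain ω₂ lam β γ) N i t (fun s => thetaCLM N (V s)) =
      -workIntegral (pinnedChain ω₂ lam β γ) N i t V := by
  unfold workIntegral
  rw [← intervalIntegral.integral_neg]
  refine intervalIntegral.integral_congr fun s _ => ?_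
  simp only [partialQ_hamiltonian_theta]
  simp [thetaCLM_apply]

/-- The bond heat is odd under `Θ`. -/
theorem bondHeat_theta (P : OscillatorChain) (i : Fin N) (t : ℝ) (V : ℝ → PhaseSpace N) :
    bondHeat P N i t (fun s => thetaCLM N (V s)) = -bondHeat P N i t V := by
  unfold bondHeat
  rw [← intervalIntegral.integral_neg]
  refine intervalIntegral.integral_congr fun s _ => ?_
  exact bondCurrent_theta P i (V s)

/-- **The raw observable of the anti-damped path**: time reversal ∘ momentum flip of the raw observable
of the reversed-drift path from `Θ y` is the raw observable of its `Θ`-conjugate from `y`. -/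
theorem obs_theta_revPath (ω₂ lam β γ : ℝ) (N : ℕ) (i0 iN ib : Fin N) (T_L T_R t : ℝ) (y : PhaseSpace N)
    (w : WienerPair) :
    swapObs N (flipObs N (rawObs (pinnedChain ω₂ lam β γ) N i0 iN ib t (y.1, -y.2)
      (revPath (pinnedChain ω₂ lam β γ) N T_L T_R (y.1, -y.2) w))) =
    rawObs (pinnedChain ω₂ lam β γ) N i0 iN ib t y (thetaRevPath ω₂ lam β γ N T_L T_R y w) := by
  have hw0 : workIntegral (pinnedChain ω₂ lam β γ) N i0 t (thetaRevPath ω₂ lam β γ N T_L T_R y w) =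
      -workIntegral (pinnedChain ω₂ lam β γ) N i0 t (revPath (pinnedChain ω₂ lam β γ) N T_L T_R (y.1, -y.2) w) :=
    workIntegral_theta ω₂ lam β γ i0 t _
  have hwN : workIntegral (pinnedChain ω₂ lam β γ) N iN t (thetaRevPath ω₂ lam β γ N T_L T_R y w) =
      -workIntegral (pinnedChain ω₂ lam β γ) N iN t (revPath (pinnedChain ω₂ lam β γ) N T_L T_R (y.1, -y.2) w) :=
    workIntegral_theta ω₂ lam β γ iN t _
  have hb : bondHeat (pinnedChain ω₂ lam β γ) N ib t (thetaRevPath ω₂ lam β γ N T_L T_R y w) =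
      -bondHeat (pinnedChain ω₂ lam β γ) N ib t (revPath (pinnedChain ω₂ lam β γ) N T_L T_R (y.1, -y.2) w) :=
    bondHeat_theta (pinnedChain ω₂ lam β γ) ib t _
  simp only [rawObs, swapObs, flipObs]
  rw [hw0, hwN, hb]
  simp [thetaRevPath]


/-- **Friction splitting of the Langevin drift** — `∀`-form registered as a sub-goal of the crux item. -/
theorem pinnedChain_drift_split :
    ∀ (ω₂ lam β γ : ℝ) (N : ℕ) (z : PhaseSpace N), (pinnedChain ω₂ lam β γ).drift N z = (pinnedChain ω₂ lam β 0).drift N z - γ • frictionVec N z :=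
  pinnedChain_drift_eq_frictionless

end Summit.AtomisticToContinuum.FouriersLaw.Theorems.LinearResponseFTUR

end
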